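import Mathlib
import Summits.KontsevichZagierPeriods.KontsevichZagierPeriods.Theorems.InverseLandauTateLiftingRotationBalls
import Summits.KontsevichZagierPeriods.KontsevichZagierPeriods.Theorems.InverseLandauTateLiftingTranscSector
import Literature.NumberTheory.Transcendental.KZRulesAssociator

/-!
# `TateLifting` (stmt-KontsevichZagierPeriods-9129), line `Sketch` — EVEN BALLS INSIDE THE RULES

`k! · ⟦B̄₂ₖ⟧ = ⟦π⟧ᵏ` in the formal period ring `P = FormalRep ⧸ relations` of the Kontsevich–Zagier calculus,
GIVEN the value `vol B̄₂ₖ = πᵏ / k!` (a separate computation): the class of the integrand-`1` closed unit ball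
`[B̄₂ₖ, 1]` lies in the subring `K₀[⟦π⟧]` generated by the dimension-zero classes and the disc
(`ball_mem_piSubring` at the constant polynomial `1`), `evalP (k! · ⟦B̄₂ₖ⟧ − ⟦π⟧ᵏ) = k! · πᵏ/k! − πᵏ = 0`, and
`evalP` is injective on `K₀[⟦π⟧]` — Lindemann read in the formal period ring (`transcRingKernel` at the
family `![⟦π⟧]`, `Transc.algebraicIndependent_vecPi`).

References: M. Kontsevich, D. Zagier, *Periods* (2001), §1.2; F. Lindemann (1882) through
`transcendental_pi_holds`.
-/

noncomputable section

open MeasureTheory Set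
open Literature.NumberTheory.Transcendental

namespace Summit.KontsevichZagierPeriods.InverseLandau

namespace BallEven

/-- `{⟦π⟧} ⊆ range ![⟦π⟧]`, hence `K₀ ∪ {⟦π⟧} ⊆ K₀ ∪ range ![⟦π⟧]`. [folklore] -/
theorem piSubring_generators_subset :
    Set.range (fun b : KZ.IntegralRep 0 => KZ.toFormalPeriod (KZ.of b)) ∪
        {KZ.toFormalPeriod (KZ.of KZ.piRep)} ⊆
      Set.range (fun b : KZ.IntegralRep 0 => KZ.toFormalPeriod (KZ.of b)) ∪
        Set.range (![KZ.toFormalPeriod (KZ.of KZ.piRep)] : Fin 1 → KZ.FormalPeriodRing) := by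
  refine Set.union_subset_union_right _ ?_
  rintro _ rfl
  exact ⟨0, by simp⟩

/-- The class of an integrand-`1` closed unit ball representation (any dimension) lies in `K₀[⟦π⟧]`:
`ball_mem_piSubring` at the constant polynomial `P = 1`. [cite: KontsevichZagier2001, §1.2] -/
theorem toFormalPeriod_ball_mem {n : ℕ} (b : KZ.IntegralRep n)
    (hb : b.domain = {v | ∑ j, v j ^ 2 ≤ 1}) (hbi : ∀ v ∈ b.domain, b.integrand v = 1) :
    KZ.toFormalPeriod (KZ.of b) ∈ Subring.closure
      (Set.range (fun b : KZ.IntegralRep 0 => KZ.toFormalPeriod (KZ.of b)) ∪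
        Set.range (![KZ.toFormalPeriod (KZ.of KZ.piRep)] : Fin 1 → KZ.FormalPeriodRing)) :=
  Subring.closure_mono piSubring_generators_subset
    (ball_mem_piSubring n 1 b hb (fun v hv => by simp only [hbi v hv, map_one]))

/-- `⟦π⟧ ∈ K₀[⟦π⟧]`. [folklore] -/
theorem toFormalPeriod_piRep_mem :
    KZ.toFormalPeriod (KZ.of KZ.piRep) ∈ Subring.closure
      (Set.range (fun b : KZ.IntegralRep 0 => KZ.toFormalPeriod (KZ.of b)) ∪
        Set.range (![KZ.toFormalPeriod (KZ.of KZ.piRep)] : Fin 1 → KZ.FormalPeriodRing)) :=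
  Subring.subset_closure (Or.inr ⟨0, by simp⟩)

end BallEven

open BallEven

/-- **EVEN BALLS INSIDE THE RULES.** If the closed unit ball `B̄₂ₖ ⊆ ℝ²ᵏ` has volume `πᵏ / k!` (for every
integrand-`1` representation over it), then `k! · ⟦B̄₂ₖ, 1⟧ = ⟦π⟧ᵏ` in the formal period ring: the
difference lies in `K₀[⟦π⟧]` (`ball_mem_piSubring`) and has value `k! · πᵏ/k! − πᵏ = 0`, so it vanishes by
the injectivity of `evalP` on `K₀[⟦π⟧]` (`transcRingKernel`, Lindemann). [cite: KontsevichZagier2001, §1.2] -/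
theorem tateLifting_ballEven :
    (∀ (k : ℕ) (b : KZ.IntegralRep (2 * k)), b.domain = {v | ∑ j, v j ^ 2 ≤ 1} →
      (∀ v ∈ b.domain, b.integrand v = 1) → b.value = Real.pi ^ k / (Nat.factorial k : ℝ)) →
    ∀ (k : ℕ) (b : KZ.IntegralRep (2 * k)), b.domain = {v | ∑ j, v j ^ 2 ≤ 1} →
      (∀ v ∈ b.domain, b.integrand v = 1) →
      (Nat.factorial k : KZ.FormalPeriodRing) * KZ.toFormalPeriod (KZ.of b) = KZ.toFormalPeriod (KZ.of KZ.piRep) ^ k := by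
  intro hval k b hb hbi
  refine sub_eq_zero.1 (transcRingKernel _ Transc.algebraicIndependent_vecPi _ ?_ ?_)
  · exact Subring.sub_mem _
      (Subring.mul_mem _ (natCast_mem _ _) (toFormalPeriod_ball_mem b hb hbi))
      (Subring.pow_mem _ toFormalPeriod_piRep_mem k)
  · rw [map_sub, map_mul, map_pow, map_natCast, KZ.evalP_toFormalPeriod_of, KZ.evalP_toFormalPeriod_of,
      KZ.piRep_value, hval k b hb hbi,
      mul_div_cancel₀ _ (Nat.cast_ne_zero.2 (Nat.factorial_ne_zero k)), sub_self]

end Summit.KontsevichZagierPeriods.InverseLandau
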